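import Literature.Barriers.CriticalPhenomena.SupercriticalSAWSpaceFillingSubcritical
import Literature.Barriers.CriticalPhenomena.SupercriticalSAWSpaceFillingProofsOnto
import Literature.Probability.RandomPlanarGeometry.CritPercSLESpaceFillingIffTraceEight
import Literature.Probability.RandomPlanarGeometry.SLEExistenceConverse
import HarnessLib

/-!
# Barrier mechanism, sixth audit: the space-filling phase `κ ≥ 8` enters the tree — under an
# SLE_κ limit, "weakly space-filling" is EQUIVALENT to `κ ≥ 8`; subcritical walks converge to no
# chordal SLE whatsoever; the `(x, κ)` phase constraint of Duminil-Copin–Kozma–Yadin's picture is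
# machine-checked, and two-sided robustness of "SLE_κ for some `κ(x)`" is refuted

Barrier catalogue `Literature/Barriers/CriticalPhenomena/` (D-0021); sixth audit (2026-08-16,
refuter, "barrier-audit" gen 6) of the mechanism file `…Proofs` of `SupercriticalSAWSpaceFilling`
(= Theorem 1 of H. Duminil-Copin, G. Kozma, A. Yadin, *Supercritical self-avoiding walks are
space-filling*, Ann. IHP Probab. Stat. 50 (2014) 315–326, arXiv:1110.3074 — PROVED in the tree,
`SupercriticalSAWSpaceFilling_holds`; `blocks:` line `¬ RobustSAWScalingLimit` proved with no
hypothesis, `SupercriticalSAW.not_robustSAWScalingLimit`). Generations 1–5 settled the fugacity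
axis on both sides for the conclusion "chordal SLE_κ, `0 < κ < 8`" (`…Unconditional`,
`…BelowEight`, `…Subcritical`: `SAWScalingLimitAt x → x = x_c` for `x > 0`, axioms re-checked in
this audit: `propext`, `Classical.choice`, `Quot.sound`), proved that the mechanism is an
equivalence on limit laws (`…ProofsOnto`: weakly space-filling iff the limit is a.s. ONTO the
domain) and left exactly two inputs / caveats standing in the catalogue entry, both about the
space-filling phase `κ ≥ 8` of SLE:

* `…ProofsOnto`, `scope_caveats`: "the `κ ≥ 8` onto-ness entering
  `isSpaceFillingLaws_of_convergesInLawToSLE` is an input (space-filling of SLE_κ, `κ ≥ 8`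
  [LSW04, §2.3]), not proved in the tree";
* `…Subcritical`, `scope_caveats`: "limits SLE_κ with `κ ≥ 8` at `x < x_c` are excluded in
  substance (thin limits are not onto) but the declarations are for `0 < κ < 8`".

Outcome of this audit: **CONFIRMED at page level and STRENGTHENED — both caveats are discharged
from theorems already in the tree but unused by the earlier audits (Rohde–Schramm's Cor. 7.4,
`Literature.Probability.RandomPlanarGeometry.ae_isSpaceFilling_sleTrace_of_hasSLETrace_apply`,
`CritPercSLESpaceFillingIffTraceEight.lean`), which completes the machine-checked `(x, κ)` phase
constraint; one evasion of the catalogue ((vii), "SLE_κ for some `κ(x)`") is shown to be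
RIGHT-half-open only.**

## What the audit found

1. **Chordal SLE_κ in `(D; a, b)`, `κ ≥ 8`, is almost surely onto `D` — unconditionally, even at
   `κ = 8`** (`ae_carrier_subset_range_of_isSLECurve_of_eight_le`). Rohde–Schramm, Cor. 7.4
   (arXiv p. 18: "Suppose that `κ > 8`, then `γ[0,∞) = ℍ̄` a.s."; Update: "Corollary 7.4 and
   Theorem 7.1 are true also for `κ = 8`. The proofs are based on the extension [LSW] to `κ = 8` of
   Theorem 5.1") is a theorem of the tree in exactly its printed conditional form for every
   `κ ≥ 8`: IF SLE_κ is generated by a curve, THEN a.s. `γ[0,∞) = ℍ̄`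
   (`ae_isSpaceFilling_sleTrace_of_hasSLETrace_apply`, from `RohdeSchramm2005_cor35_holds`). The
   point the earlier audits did not exploit (it is recorded on the SLE side of the library,
   `IsSLECurve.hasSLETrace` of `SLEExistenceConverse.lean`): the library's notion of a chordal
   SLE_κ random curve `IsSLECurve κ D Γ` CONTAINS the almost-sure generation of the Loewner chain
   by its trace, so any SLE_κ curve witnesses `HasSLETrace κ` — the Lawler–Schramm–Werner SLE₈
   trace theorem is needed to CONSTRUCT an SLE₈ curve, never to USE one. Transport through the
   uniformizing map `φ : ℍ → D` (every `z ∈ D` is `φ(γ(t))` for some `t`, and `φ ∘ γ` compactified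
   is the curve) gives onto-ness in `D`.
2. **The `κ ≥ 8` input of `…ProofsOnto` is discharged** (`isSpaceFillingLaws_of_convergesInLawToSLE_of_eight_le`):
   SAW laws (any domain, any endpoints, any finite laws — in particular the fugacity-`x` laws at
   ANY `x`, `isSpaceFillingFamily_of_convergesInLawToSLE_of_eight_le`) converging in the curve
   topology to chordal SLE_κ, `κ ≥ 8`, ARE weakly space-filling in the printed sense of §1 of the
   source. With `…BelowEight` this is a **dichotomy** (`isSpaceFillingLaws_iff_eight_le_of_convergesInLawToSLE`):
   *under convergence to chordal SLE_κ (`κ > 0`), the laws are weakly space-filling iff `κ ≥ 8`.*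
   So Conjecture 11 of the source for `x > 1/μ` (SLE₈, p. 8) implies the §1 expectation
   ("γ_δ is expected to become space-filling in the following sense", p. 2) with no further input,
   and conversely an SLE_κ description of the supercritical phase must have `κ ≥ 8`.
3. **Subcritical walks converge to no chordal SLE at all** (`not_convergesInLawToSLE_subcritical_unitDisc`,
   `0 < x < x_c`, unit disc, any endpoints in `𝔻_δ`, every `κ > 0`). The missing case `κ ≥ 8` is
   "short families converge to no ONTO curve" (`not_ae_carrier_subset_range_of_short`: a.s. the
   `ρ`-tube of the limit has volume `≤ 9π(C+1)ρ` by `ae_measure_tube_le_of_tendstoLaw` of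
   `…Subcritical`, while the tube of an onto curve contains a fixed ball of `D`), combined with
   item 1 (`not_convergesInLawToSLE_of_short_of_eight_le`, `not_convergesInLawToSLE_of_short'`).
4. **The `(x, κ)` phase constraint, machine-checked** (`eq_criticalFugacity_or_eight_le_of_convergesInLawToSLE_unitDisc`):
   if the fugacity-`x` SAW (`x > 0`) of `(𝔻; 1, -1)` with closest-site endpoints converges in
   the curve topology to chordal SLE_κ (`κ > 0`), then `x = x_c`, or `x > x_c` and `κ ≥ 8`. In
   words: the subcritical half-line carries no SLE, the supercritical one only the space-filling
   SLEs, and every SLE_κ with `κ < 8` pins the fugacity to `x_c = 1/μ(ℤ²)` EXACTLY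
   (`eq_criticalFugacity_of_convergesInLawToSLE_unitDisc_of_lt_eight`; for `κ = 8/3` this was
   `eq_criticalFugacity_of_sawScalingLimitAt` of `…Subcritical`), while ANY SLE identification
   certifies `x ≥ x_c` (`criticalFugacity_le_of_convergesInLawToSLE_unitDisc`, any `κ > 0`, any
   endpoints). What is left undecided is exactly what is open in print: the law at `x_c`
   (Conjecture 11: SLE_{8/3}; Problem 10: not space-filling) and `κ = 8` versus `κ > 8` above
   `x_c` (Conjecture 11: SLE₈).
5. **Evasion (vii) is right-half-open only** (`not_forall_Ioo_exists_convergesInLawToSLE_unitDisc`):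
   the catalogue lists among the `x`-robust conclusions NOT obstructed by Theorem 1 "chordal SLE_κ
   for SOME `κ = κ(x)`", "predicted for all `x ≥ x_c`" — correct as stated, but a TWO-SIDED
   neighbourhood version (`∀ x ∈ (x_c - ε, x_c + ε), ∃ κ(x) > 0`, SLE_{κ(x)} limit) is now refuted
   for every `ε > 0`: no `x < x_c` carries an SLE limit (item 3). Of the (vii)-list, only the
   conclusions true of the subcritical degenerate limit as well (tightness, existence of
   subsequential limits, support on curves from `a` to `b` in `D̄`, reversibility, the domain
   Markov property) can be two-sidedly robust; "conformally invariant non-degenerate limit" and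
   "SLE_κ for some `κ`" are at best RIGHT-robust (`x ∈ [x_c, x_c + ε)`, with `κ(x) ≥ 8` for
   `x > x_c` by item 4 — so `κ(x)` jumps at `x_c` and cannot be obtained by continuity in `x`).
6. **A positive reading for planners (trivial given gen 5, recorded because no declaration said
   it):** `sawScalingLimit_iff_exists_pos` — the sub-problem is EQUIVALENT to the existential
   statement "SLE_{8/3} convergence holds at SOME fugacity `x > 0`". The barrier forbids arguments
   valid on a set of fugacities larger than a point; it does not require knowing `μ(ℤ²)`: a route
   may treat the fugacity as an unknown pinned by a balance / variational condition, and an SLE_κ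
   limit (`κ < 8`) at the resulting `x` locates `x_c` for free (item 4).
7. **Confirmed (page level, arXiv text of the source, re-read in this audit).** p. 2: the weak
   sense of space-filling, "It should be the Schramm-Löwner Evolution of parameter 8, which is
   conformally invariant", Theorem 1 verbatim; p. 3: "We present the proof only in the case
   `d = 2`, even though the reasoning carries over to all dimensions without difficulty … One can
   also extend the result to other lattices with sufficient symmetry in a straightforward way (for
   instance to the hexagonal lattice)" — so the lattice of Conjecture 11 is covered at remark
   level; p. 8: "It is not difficult to show that the length is of order `1/δ²`", Problems 9–10,
   Conjecture 11. Forward citations (`lit citing`, API refresh 2026-08-16: 27 works, 4 since 2022 —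
   quantitative sub-ballisticity arXiv:2310.17299, the XOR-trick loop-O(n) paper arXiv:2001.11977,
   a laudatio, one off-topic): none evades or contradicts Theorem 1; broad discovery
   (`lit galaxy`, all corpora) surfaces only the catalogued surveys [PeledSpinka2019],
   Duminil-Copin's parafermionic lecture notes and direction-weighted walks (Grimmett–Li,
   model-parameter axis (vi)).

## Formal content (all proved; one new closed `Prop`, `SupercriticalSAWSpaceFillingPhases`)

`ae_carrier_subset_range_of_isSLECurve_of_eight_le`,
`isSpaceFillingLaws_of_convergesInLawToSLE_of_eight_le`,
`isSpaceFillingFamily_of_convergesInLawToSLE_of_eight_le`,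
`isSpaceFillingLaws_iff_eight_le_of_convergesInLawToSLE`; `not_ae_carrier_subset_range_of_short`,
`not_convergesInLawToSLE_of_short_of_eight_le`, `not_convergesInLawToSLE_of_short'`,
`not_convergesInLawToSLE_subcritical_unitDisc`; `criticalFugacity_le_of_convergesInLawToSLE_unitDisc`,
`eight_le_of_convergesInLawToSLE_unitDisc`, `eq_criticalFugacity_or_eight_le_of_convergesInLawToSLE_unitDisc`,
`eq_criticalFugacity_of_convergesInLawToSLE_unitDisc_of_lt_eight`,
`not_forall_Ioo_exists_convergesInLawToSLE_unitDisc`, `sawScalingLimit_iff_exists_pos`; the closed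
`Prop` `SupercriticalSAWSpaceFillingPhases` and `SupercriticalSAWSpaceFillingPhases_holds`.

Mathlib: `Complex.volume_ball`, `Metric.infDist_zero_of_mem`, `MeasureTheory.ae_neBot`,
`ENNReal.ofReal_le_ofReal_iff`, `ENNReal.ofReal_pow`, `ENNReal.ofReal_mul`, `Filter.Eventually.exists`.

## References (page-level, audit 2026-08-16; pages of the arXiv versions)

* H. Duminil-Copin, G. Kozma, A. Yadin, Ann. IHP Probab. Stat. 50 (2014) 315–326,
  arXiv:1110.3074: p. 2 (§1; Theorem 1), p. 3 (all dimensions; other lattices, hexagonal),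
  p. 8 (§4: length of order `1/δ²`, Problems 9–10, Conjecture 11). [DuminilCopinKozmaYadin2014]
* S. Rohde, O. Schramm, *Basic properties of SLE*, Ann. of Math. 161 (2005) 883–924,
  arXiv:math/0106036: p. 18, Cor. 7.4 (= "Corollary (spacefill)": `κ > 8 ⇒ γ[0,∞) = ℍ̄` a.s.)
  and the Update following it (`κ = 8`, via [LSW04] Thm 4.7); p. 4 ("the trace is space-filling
  for `κ > 8`"). [RohdeSchramm2005]
* G. F. Lawler, O. Schramm, W. Werner, *Conformal invariance of planar loop-erased random walks
  and uniform spanning trees*, Ann. Probab. 32 (2004) 939–995, Thm 4.7 (SLE₈ is generated by a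
  curve) — NOT an input here. [LawlerSchrammWerner2004]
* G. F. Lawler, O. Schramm, W. Werner, *On the scaling limit of planar self-avoiding walk* (2004),
  arXiv:math/0204277: p. 7, §2.3 ("For `κ ≥ 8` the curves are space filling"). [LawlerSchrammWerner2004SAW]
* V. Beffara, Ann. Probab. 36 (2008), Prop. 4; P. Billingsley (1999), Thm 2.1 — inputs of the
  `κ < 8` half inherited from `…Subcritical`. [Beffara2008] [Billingsley1999]
-/

noncomputable section

open MeasureTheory Filter Topology Metric Set Literature.Probability.LatticeModels
  Literature.Probability.Percolation Literature.Probability.RandomPlanarGeometry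
  Literature.Probability.RandomPlanarGeometry.SAW
open UpperHalfPlane (upperHalfPlaneSet isOpen_upperHalfPlaneSet)
open scoped ENNReal NNReal

namespace Literature.Barriers.CriticalPhenomena

namespace SupercriticalSAW

section SpaceFillingPhase

variable {κ : ℝ≥0} {D : DobrushinDomain} {Γ : (ℝ≥0 → ℝ) → CurveClass ℂ}

/-- **Chordal SLE_κ in `(D; a, b)`, `κ ≥ 8`, is almost surely ONTO `D`** — unconditionally, even
at `κ = 8`: an SLE_κ random curve of the library witnesses that SLE_κ is generated by a curve
(`IsSLECurve.hasSLETrace`, `SLEExistenceConverse.lean`), so Rohde–Schramm's Cor. 7.4 in its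
printed conditional form (`ae_isSpaceFilling_sleTrace_of_hasSLETrace_apply`: a.s.
`γ[0,∞) = ℍ̄`) applies; every `z ∈ D` is then `φ(γ(t))` for the uniformizing map `φ : ℍ → D`, a
point of the compactified image curve `Γ ω`. The `κ ≥ 8` counterpart of
`not_ae_carrier_subset_range_of_isSLECurve_of_lt_eight'` (`…BelowEight`).
[cite: RohdeSchramm2005, Cor. 7.4] -/
theorem ae_carrier_subset_range_of_isSLECurve_of_eight_le (h8 : 8 ≤ κ) (hΓ : IsSLECurve κ D Γ) :
    ∀ᵐ ω ∂Literature.Probability.Process.preWienerMeasure, D.carrier ⊆ (Γ ω).range := by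
  have hT : HasSLETrace κ := hΓ.hasSLETrace
  obtain ⟨-, φ, -, hae⟩ := hΓ
  filter_upwards [hae, ae_isSpaceFilling_sleTrace_of_hasSLETrace_apply h8 hT] with
    ω ⟨_, c, hΓω, hc⟩ hsf
  intro z hz
  have hw : φ.symm z ∈ upperHalfPlaneSet := φ.symm_mapsTo hz
  have hrange : Set.range (sleTrace κ ω) = closure upperHalfPlaneSet := hsf
  have hwr : φ.symm z ∈ Set.range (sleTrace κ ω) := by
    rw [hrange]
    exact subset_closure hw
  obtain ⟨t, ht⟩ := hwr
  obtain ⟨s, hs1, hst⟩ := exists_rayParam_eq t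
  rw [hΓω, CurveClass.range_mk]
  refine ⟨s, ?_⟩
  rw [hc.1 s hs1, hst, ht, φ.boundaryExtension_eq hw, φ.apply_symm_apply hz]


variable {A B : ℝ → Site 2} {P : ∀ δ : ℝ, Measure (DomainSAW D.carrier δ (A δ) (B δ))}

/-- **The `κ ≥ 8` input of `…ProofsOnto` discharged**: if SAW laws converge in law (curve
topology) to chordal SLE_κ with `κ ≥ 8`, they are weakly space-filling in the sense of §1 of the
source — unconditionally (at `κ = 8` the SLE₈ trace theorem is not needed as a separate input:
convergence to SLE₈ presupposes an SLE₈ random curve, which carries the generation of the chain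
by its trace). [cite: DuminilCopinKozmaYadin2014, §1 and Conjecture 11] -/
theorem isSpaceFillingLaws_of_convergesInLawToSLE_of_eight_le [∀ δ, IsFiniteMeasure (P δ)]
    (h8 : 8 ≤ κ)
    (h : ConvergesInLawToSLE κ D (fun δ (γ : DomainSAW D.carrier δ (A δ) (B δ)) => γ.curve) P) :
    IsSpaceFillingLaws D.carrier A B P :=
  isSpaceFillingLaws_of_convergesInLawToSLE h fun _ hΓ =>
    ae_carrier_subset_range_of_isSLECurve_of_eight_le h8 hΓ

/-- The same for the fugacity-`x` laws: convergence of the SAW with parameter `x` to chordal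
SLE_κ, `κ ≥ 8`, implies the printed weak space-filling property (`IsSpaceFillingFamily`).
[cite: DuminilCopinKozmaYadin2014, §1 and Conjecture 11] -/
theorem isSpaceFillingFamily_of_convergesInLawToSLE_of_eight_le {x : ℝ} (h8 : 8 ≤ κ)
    (h : ConvergesInLawToSLE κ D (fun δ (γ : DomainSAW D.carrier δ (A δ) (B δ)) => γ.curve)
      fun δ => lawAt x D.carrier δ (A δ) (B δ)) :
    IsSpaceFillingFamily x D.carrier A B :=
  isSpaceFillingLaws_lawAt_iff.1 (isSpaceFillingLaws_of_convergesInLawToSLE_of_eight_le h8 h)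

/-- **Dichotomy.** Under convergence in law of SAW laws to chordal SLE_κ (`κ > 0`) in the curve
topology, the laws are weakly space-filling in `D` if and only if `κ ≥ 8`: `←` is the previous
theorem, `→` is `IsSpaceFillingLaws.not_convergesInLawToSLE_of_lt_eight` (`…BelowEight`).
Hypothesis-free. [cite: DuminilCopinKozmaYadin2014, §1 and Conjecture 11] -/
theorem isSpaceFillingLaws_iff_eight_le_of_convergesInLawToSLE [∀ δ, IsFiniteMeasure (P δ)]
    (h0 : 0 < κ)
    (h : ConvergesInLawToSLE κ D (fun δ (γ : DomainSAW D.carrier δ (A δ) (B δ)) => γ.curve) P) :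
    IsSpaceFillingLaws D.carrier A B P ↔ 8 ≤ κ := by
  refine ⟨fun hfill => not_lt.1 fun h8 => hfill.not_convergesInLawToSLE_of_lt_eight h0 h8 h,
    fun h8 => isSpaceFillingLaws_of_convergesInLawToSLE_of_eight_le h8 h⟩

end SpaceFillingPhase

/-! ### Short families converge to no onto curve: the subcritical side for every `κ > 0` -/

section ShortOnto

variable {D : DobrushinDomain} {A B : ℝ → Site 2}

/-- **Limits in law of short SAW families are not onto.** If finite laws `P δ` on the SAWs of
`Ω_δ` (`Ω = D.carrier`) give walks of more than `C/δ` steps probability `→ 0` and the polylines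
converge in law to a random curve class `Γ` under a non-zero finite measure `W`, then `Γ` is not
almost surely onto `D`: a.s. the `ρ`-tube of the trace has volume `≤ 9π(C+1)ρ`
(`ae_measure_tube_le_of_tendstoLaw`), but the tube of an onto curve contains a fixed ball of `D`.
[cite: Billingsley1999, Thm 2.1] -/
theorem not_ae_carrier_subset_range_of_short
    {P : ∀ δ, Measure (DomainSAW D.carrier δ (A δ) (B δ))} [∀ δ, IsFiniteMeasure (P δ)]
    {Ω' : Type*} [MeasurableSpace Ω'] {W : Measure Ω'} [IsFiniteMeasure W] (hW : W ≠ 0)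
    {Γ : Ω' → CurveClass ℂ} (hΓ : AEMeasurable Γ W)
    (hT : TendstoLaw (fun δ (γ : DomainSAW D.carrier δ (A δ) (B δ)) => γ.curve) P Γ W)
    {C : ℝ} (hC : 0 ≤ C) (hshort : Tendsto (fun δ => P δ {γ | C / δ < γ.length}) (𝓝[>] 0) (𝓝 0)) :
    ¬ ∀ᵐ ω ∂W, D.carrier ⊆ (Γ ω).range := by
  intro honto
  haveI : (ae W).NeBot := ae_neBot.2 hW
  obtain ⟨w₀, hw₀⟩ := D.isConnected.nonempty
  obtain ⟨r, hr, hballD⟩ := Metric.isOpen_iff.1 D.isOpen w₀ hw₀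
  have hC1 : 0 < C + 1 := by linarith
  set ρ : ℝ := min 1 (r ^ 2 / (18 * (C + 1))) with hρ
  have hρ0 : 0 < ρ := lt_min one_pos (by positivity)
  have hρ1 : ρ ≤ 1 := min_le_left _ _
  have hthin := ae_measure_tube_le_of_tendstoLaw hΓ hT hC hshort hρ0 hρ1
  obtain ⟨ω, h1, h2⟩ := (hthin.and honto).exists
  have hsub : ball w₀ r ⊆ {w | infDist w (Γ ω).range < ρ} := fun w hw => by
    have hw' : w ∈ (Γ ω).range := h2 (hballD hw)
    show infDist w (Γ ω).range < ρ
    rw [infDist_zero_of_mem hw']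
    exact hρ0
  have hle := (measure_mono hsub).trans h1
  have hpi : (NNReal.pi : ℝ≥0∞) = ENNReal.ofReal Real.pi := by
    rw [← ENNReal.ofReal_coe_nnreal, NNReal.coe_real_pi]
  rw [Complex.volume_ball, hpi, ← ENNReal.ofReal_pow hr.le, ← ENNReal.ofReal_mul (sq_nonneg r)]
    at hle
  have h9 : 0 ≤ 9 * Real.pi * (C + 1) * ρ :=
    mul_nonneg (mul_nonneg (by positivity) hC1.le) hρ0.le
  have hle' := (ENNReal.ofReal_le_ofReal_iff h9).1 hle
  have hρle : ρ ≤ r ^ 2 / (18 * (C + 1)) := min_le_right _ _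
  have hbound : 9 * Real.pi * (C + 1) * ρ ≤ Real.pi * r ^ 2 / 2 := by
    calc 9 * Real.pi * (C + 1) * ρ ≤ 9 * Real.pi * (C + 1) * (r ^ 2 / (18 * (C + 1))) := by
          gcongr
      _ = Real.pi * r ^ 2 / 2 := by
          field_simp
          ring
  nlinarith [Real.pi_pos, sq_pos_of_pos hr]

variable {κ : ℝ≥0}

/-- **Short SAW families converge to no chordal SLE_κ with `κ ≥ 8`**: such an SLE is a.s. onto
the domain (`ae_carrier_subset_range_of_isSLECurve_of_eight_le`), a short limit is not.
[cite: RohdeSchramm2005, Cor. 7.4] -/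
theorem not_convergesInLawToSLE_of_short_of_eight_le (h8 : 8 ≤ κ)
    {P : ∀ δ, Measure (DomainSAW D.carrier δ (A δ) (B δ))} (hP : ∀ δ, IsFiniteMeasure (P δ))
    {C : ℝ} (hC : 0 ≤ C) (hshort : Tendsto (fun δ => P δ {γ | C / δ < γ.length}) (𝓝[>] 0) (𝓝 0)) :
    ¬ ConvergesInLawToSLE κ D (fun δ (γ : DomainSAW D.carrier δ (A δ) (B δ)) => γ.curve) P := by
  haveI := hP
  rintro ⟨Γ, hΓ, -, hT⟩
  haveI : IsProbabilityMeasure Literature.Probability.Process.preWienerMeasure :=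
    isProbabilityMeasure_preWienerMeasure'
  exact not_ae_carrier_subset_range_of_short (IsProbabilityMeasure.ne_zero _) hΓ.aemeasurable hT
    hC hshort (ae_carrier_subset_range_of_isSLECurve_of_eight_le h8 hΓ)

/-- **Short SAW families converge to no chordal SLE_κ whatsoever (`κ > 0`)**: `κ < 8` is
`not_convergesInLawToSLE_of_short` (`…Subcritical`, thin limits versus Beffara's one-point lower
estimate), `κ ≥ 8` is the previous theorem. [cite: Beffara2008, Prop. 4] -/
theorem not_convergesInLawToSLE_of_short' (h0 : 0 < κ)
    {P : ∀ δ, Measure (DomainSAW D.carrier δ (A δ) (B δ))} (hP : ∀ δ, IsFiniteMeasure (P δ))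
    {C : ℝ} (hC : 0 ≤ C) (hshort : Tendsto (fun δ => P δ {γ | C / δ < γ.length}) (𝓝[>] 0) (𝓝 0)) :
    ¬ ConvergesInLawToSLE κ D (fun δ (γ : DomainSAW D.carrier δ (A δ) (B δ)) => γ.curve) P := by
  rcases lt_or_ge κ 8 with h8 | h8
  · exact not_convergesInLawToSLE_of_short h0 h8 hP hC hshort
  · exact not_convergesInLawToSLE_of_short_of_eight_le h8 hP hC hshort

/-- **The fugacity-`x` SAW in the unit disc, `0 < x < x_c`, converges to no chordal SLE_κ for ANY
`κ > 0`** (any endpoints `A δ, B δ ∈ 𝔻_δ`): the case `κ ≥ 8` left open by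
`not_convergesInLawToSLE_subcritical_unitDisc_of_lt_eight` (`…Subcritical`).
[cite: DuminilCopinKozmaYadin2014, §1 (When x < 1/μ)] -/
theorem not_convergesInLawToSLE_subcritical_unitDisc {x : ℝ} (hx0 : 0 < x)
    (hxc : x < criticalFugacity) (h0 : 0 < κ)
    (hAB : ∀ δ : ℝ, 0 < δ → A δ ∈ meshDomain unitDisk δ ∧ B δ ∈ meshDomain unitDisk δ) :
    ¬ ConvergesInLawToSLE κ DobrushinDomain.unitDisc
        (fun δ (γ : DomainSAW DobrushinDomain.unitDisc.carrier δ (A δ) (B δ)) => γ.curve)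
        (fun δ => lawAt x DobrushinDomain.unitDisc.carrier δ (A δ) (B δ)) := by
  obtain ⟨C, hC, hshort⟩ := tendsto_lawAt_length_lt_of_lt_criticalFugacity hx0 hxc hAB
  exact not_convergesInLawToSLE_of_short' (D := DobrushinDomain.unitDisc) h0
    (P := fun δ => lawAt x unitDisk δ (A δ) (B δ))
    (fun δ => isFiniteMeasure_lawAt x unitDisk δ (A δ) (B δ)) hC.le hshort

end ShortOnto

/-! ### The `(x, κ)` phase constraint in the unit disc -/

section Phases

variable {κ : ℝ≥0} {A B : ℝ → Site 2}

/-- **An SLE_κ limit at fugacity `x` certifies `x ≥ x_c`** (any `κ > 0`, any endpoints in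
`𝔻_δ`): a chordal SLE identification of the fugacity-`x` SAW of the unit disc is a rigorous bound
`μ(ℤ²) ≥ 1/x` on the connective constant. [cite: DuminilCopinKozmaYadin2014, §1] -/
theorem criticalFugacity_le_of_convergesInLawToSLE_unitDisc {x : ℝ} (hx0 : 0 < x) (h0 : 0 < κ)
    (hAB : ∀ δ : ℝ, 0 < δ → A δ ∈ meshDomain unitDisk δ ∧ B δ ∈ meshDomain unitDisk δ)
    (h : ConvergesInLawToSLE κ DobrushinDomain.unitDisc
        (fun δ (γ : DomainSAW DobrushinDomain.unitDisc.carrier δ (A δ) (B δ)) => γ.curve)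
        (fun δ => lawAt x DobrushinDomain.unitDisc.carrier δ (A δ) (B δ))) :
    criticalFugacity ≤ x :=
  not_lt.1 fun hxc => not_convergesInLawToSLE_subcritical_unitDisc hx0 hxc h0 hAB h

/-- **Above `x_c` only the space-filling SLEs survive**: if the fugacity-`x` SAW of `(𝔻; 1, -1)`
with closest-site endpoints, `x > x_c`, converges to chordal SLE_κ (`κ > 0`), then `κ ≥ 8`
(contrapositive of `not_convergesInLawToSLE_supercritical_unitDisc_of_lt_eight`, `…BelowEight`).
[cite: DuminilCopinKozmaYadin2014, Theorem 1 and Conjecture 11] -/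
theorem eight_le_of_convergesInLawToSLE_unitDisc {x : ℝ} (hx : criticalFugacity < x) (h0 : 0 < κ)
    (hAB : ∀ δ : ℝ, 0 < δ → IsClosestSite unitDisk δ 1 (A δ) ∧ IsClosestSite unitDisk δ (-1) (B δ))
    (h : ConvergesInLawToSLE κ DobrushinDomain.unitDisc
        (fun δ (γ : DomainSAW DobrushinDomain.unitDisc.carrier δ (A δ) (B δ)) => γ.curve)
        (fun δ => lawAt x DobrushinDomain.unitDisc.carrier δ (A δ) (B δ))) :
    8 ≤ κ :=
  not_lt.1 fun h8 => not_convergesInLawToSLE_supercritical_unitDisc_of_lt_eight hx h0 h8 hAB h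

/-- **The `(x, κ)` phase constraint, machine-checked.** If the fugacity-`x` SAW (`x > 0`) of
`(𝔻; 1, -1)` with closest-site endpoints converges in the curve topology to chordal SLE_κ
(`κ > 0`), then EITHER `x = x_c` OR (`x > x_c` AND `κ ≥ 8`): the subcritical half-line carries no
SLE at all, the supercritical one only the space-filling SLEs — the complement of Conjecture 11
of the source (SLE_{8/3} at `x_c`, SLE₈ above) is excluded except for the value of `κ` at `x_c`
(Problem 10) and of `κ ≥ 8` above. [cite: DuminilCopinKozmaYadin2014, Conjecture 11] -/
theorem eq_criticalFugacity_or_eight_le_of_convergesInLawToSLE_unitDisc {x : ℝ} (hx0 : 0 < x)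
    (h0 : 0 < κ)
    (hAB : ∀ δ : ℝ, 0 < δ → IsClosestSite unitDisk δ 1 (A δ) ∧ IsClosestSite unitDisk δ (-1) (B δ))
    (h : ConvergesInLawToSLE κ DobrushinDomain.unitDisc
        (fun δ (γ : DomainSAW DobrushinDomain.unitDisc.carrier δ (A δ) (B δ)) => γ.curve)
        (fun δ => lawAt x DobrushinDomain.unitDisc.carrier δ (A δ) (B δ))) :
    x = criticalFugacity ∨ (criticalFugacity < x ∧ 8 ≤ κ) := by
  have hle := criticalFugacity_le_of_convergesInLawToSLE_unitDisc hx0 h0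
    (fun δ hδ => ⟨(hAB δ hδ).1.1, (hAB δ hδ).2.1⟩) h
  rcases hle.eq_or_lt with heq | hlt
  · exact Or.inl heq.symm
  · exact Or.inr ⟨hlt, eight_le_of_convergesInLawToSLE_unitDisc hlt h0 hAB h⟩

/-- Equivalently: an SLE_κ identification with `κ < 8` pins the fugacity to `x_c` EXACTLY (for
`κ = 8/3` this is `eq_criticalFugacity_of_sawScalingLimitAt` of `…Subcritical`, here for every
`0 < κ < 8` and one domain). [cite: DuminilCopinKozmaYadin2014, Conjecture 11] -/
theorem eq_criticalFugacity_of_convergesInLawToSLE_unitDisc_of_lt_eight {x : ℝ} (hx0 : 0 < x)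
    (h0 : 0 < κ) (h8 : κ < 8)
    (hAB : ∀ δ : ℝ, 0 < δ → IsClosestSite unitDisk δ 1 (A δ) ∧ IsClosestSite unitDisk δ (-1) (B δ))
    (h : ConvergesInLawToSLE κ DobrushinDomain.unitDisc
        (fun δ (γ : DomainSAW DobrushinDomain.unitDisc.carrier δ (A δ) (B δ)) => γ.curve)
        (fun δ => lawAt x DobrushinDomain.unitDisc.carrier δ (A δ) (B δ))) :
    x = criticalFugacity := by
  rcases eq_criticalFugacity_or_eight_le_of_convergesInLawToSLE_unitDisc hx0 h0 hAB h with h | h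
  · exact h
  · exact absurd h.2 (not_le.2 h8)

/-- **Two-sided robustness of "the limit is chordal SLE_κ for SOME `κ = κ(x)`" is refuted.** For
no `ε > 0` does the fugacity-`x` SAW of `(𝔻; 1, -1)` (closest-site endpoints) converge to a
chordal SLE_{κ(x)}, `κ(x) > 0`, for all `x ∈ (x_c - ε, x_c + ε)`: the point
`x = x_c - min (ε/2) (x_c/2)` carries no SLE limit at all. The evasion "(vii) SLE_κ for some
`κ(x)`" of `…ProofsOnto` is thus RIGHT-half-open only (`[x_c, x_c + ε)`, with `κ(x) ≥ 8` for
`x > x_c`). [cite: DuminilCopinKozmaYadin2014, §1 and Conjecture 11] -/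
theorem not_forall_Ioo_exists_convergesInLawToSLE_unitDisc {ε : ℝ} (hε : 0 < ε)
    (hAB : ∀ δ : ℝ, 0 < δ → IsClosestSite unitDisk δ 1 (A δ) ∧ IsClosestSite unitDisk δ (-1) (B δ)) :
    ¬ ∀ x ∈ Set.Ioo (criticalFugacity - ε) (criticalFugacity + ε), ∃ κ : ℝ≥0, 0 < κ ∧
        ConvergesInLawToSLE κ DobrushinDomain.unitDisc
          (fun δ (γ : DomainSAW DobrushinDomain.unitDisc.carrier δ (A δ) (B δ)) => γ.curve)
          (fun δ => lawAt x DobrushinDomain.unitDisc.carrier δ (A δ) (B δ)) := by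
  intro h
  have hxc := criticalFugacity_pos
  set x : ℝ := criticalFugacity - min (ε / 2) (criticalFugacity / 2) with hx
  have hx0 : 0 < x := by
    have := min_le_right (ε / 2) (criticalFugacity / 2)
    rw [hx]; linarith
  have hmin0 : 0 < min (ε / 2) (criticalFugacity / 2) := lt_min (by linarith) (by linarith)
  have hxlt : x < criticalFugacity := by rw [hx]; linarith
  have hxmem : x ∈ Set.Ioo (criticalFugacity - ε) (criticalFugacity + ε) := by
    refine ⟨?_, by linarith⟩
    have := min_le_left (ε / 2) (criticalFugacity / 2)
    rw [hx]; linarith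
  obtain ⟨κ, h0, hconv⟩ := h x hxmem
  exact not_convergesInLawToSLE_subcritical_unitDisc hx0 hxlt h0
    (fun δ hδ => ⟨(hAB δ hδ).1.1, (hAB δ hδ).2.1⟩) hconv

end Phases

/-! ### The sub-problem as an existential statement in the fugacity -/

section Existential

/-- **`SAWScalingLimit ↔ ∃ x > 0, SAWScalingLimitAt x`**: proving SLE_{8/3} convergence at SOME
positive fugacity — however defined, e.g. by a balance condition, without knowledge of `μ(ℤ²)` —
proves the sub-problem, because the pinning theorem (`sawScalingLimitAt_iff_of_pos`,
`…Subcritical`) forces that fugacity to be `x_c`. The barrier forbids sets of fugacities larger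
than a point, not existential quantification over the fugacity. [cite: DuminilCopinKozmaYadin2014, §1] -/
theorem sawScalingLimit_iff_exists_pos :
    SAWScalingLimit ↔ ∃ x : ℝ, 0 < x ∧ SAWScalingLimitAt x := by
  constructor
  · intro h
    exact ⟨criticalFugacity, criticalFugacity_pos, sawScalingLimitAt_criticalFugacity.2 h⟩
  · rintro ⟨x, hx0, hx⟩
    exact ((sawScalingLimitAt_iff_of_pos hx0).1 hx).2

end Existential

end SupercriticalSAW

open SupercriticalSAW

/-! ### The audited barrier (sixth audit): the `(x, κ)` phase constraint -/

/-- **Barrier `SupercriticalSAWSpaceFillingPhases`** (sixth audit of the mechanism of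
`SupercriticalSAWSpaceFilling`; PROVED below, `SupercriticalSAWSpaceFillingPhases_holds`):
Theorem 1 of Duminil-Copin–Kozma–Yadin together with (a) the discharge of the space-filling
phase of SLE — under convergence of SAW laws to chordal SLE_κ, `κ ≥ 8`, the laws ARE weakly
space-filling (any domain, endpoints, finite laws) — and (b) the `(x, κ)` phase constraint in
the unit disc: an SLE_κ limit (`κ > 0`) of the fugacity-`x` SAW (`x > 0`, closest-site endpoints
of `(𝔻; 1, -1)`) forces `x = x_c`, or `x > x_c` and `κ ≥ 8`.

BARRIER (structured block, D-0021):
- technique_class: that of `SupercriticalSAWSpaceFilling` / `…Subcritical` (fugacity-robust, δ-uniform conclusions about the curve-topology limit of the fugacity-`x` SAW), now for EVERY `κ > 0` and with the space-filling phase explicit: any argument whose conclusion — identification of the limit in law with a chordal SLE_κ in the topology `d` of curves modulo reparametrisation — would hold at some fugacity `0 < x < x_c` (any `κ > 0`), or at some `x > x_c` with `κ < 8`, or (two-sidedly) "SLE_κ for SOME `κ = κ(x)`" on a neighbourhood `(x_c - ε, x_c + ε)` [cite: DuminilCopinKozmaYadin2014, §1 and Conjecture 11]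
- blocks: everything the base barrier and `…Subcritical` block, and (proved here) for `0 < x < x_c`, in the unit disc with ANY endpoints in `𝔻_δ`, convergence of the fugacity-`x` laws to chordal SLE_κ for ANY `κ > 0` (`SupercriticalSAW.not_convergesInLawToSLE_subcritical_unitDisc`; generally, convergence to any SLE of any family of finite SAW laws with `|γ_δ| ≤ C/δ` w.h.p., `SupercriticalSAW.not_convergesInLawToSLE_of_short'`, and to any a.s.-ONTO random curve, `SupercriticalSAW.not_ae_carrier_subset_range_of_short`); the two-sided class `∀ x ∈ (x_c - ε, x_c + ε), ∃ κ(x) > 0, SLE_{κ(x)}` for every `ε > 0` (`SupercriticalSAW.not_forall_Ioo_exists_convergesInLawToSLE_unitDisc`); consequences: `SupercriticalSAW.eq_criticalFugacity_or_eight_le_of_convergesInLawToSLE_unitDisc` (an SLE_κ limit at `x` forces `x = x_c ∨ (x_c < x ∧ 8 ≤ κ)`), `SupercriticalSAW.criticalFugacity_le_of_convergesInLawToSLE_unitDisc` (ANY SLE identification certifies `x ≥ x_c`, i.e. `μ(ℤ²) ≥ 1/x`), `SupercriticalSAW.eq_criticalFugacity_of_convergesInLawToSLE_unitDisc_of_lt_eight`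 (every SLE_κ, `κ < 8`, pins `x = x_c`); and the DISCHARGE of the `κ ≥ 8` input of `…ProofsOnto`: `SupercriticalSAW.ae_carrier_subset_range_of_isSLECurve_of_eight_le` (chordal SLE_κ, `κ ≥ 8`, is a.s. onto `D`, unconditionally — an SLE curve of the library carries the generation of its chain by the trace, `Literature.Probability.RandomPlanarGeometry.IsSLECurve.hasSLETrace`) [cite: RohdeSchramm2005, Cor. 7.4], `SupercriticalSAW.isSpaceFillingLaws_of_convergesInLawToSLE_of_eight_le` and the dichotomy `SupercriticalSAW.isSpaceFillingLaws_iff_eight_le_of_convergesInLawToSLE` (under an SLE_κ limit, weakly space-filling ⇔ `κ ≥ 8`) [cite: DuminilCopinKozmaYadin2014, §1 and Conjecture 11]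
- because: for `κ ≥ 8`, if the chain of `√κ B` is generated by a curve `γ` then a.s. `γ[0,∞) = ℍ̄` (dense by Rohde–Schramm's Lemma 6.3 with (6.2), closed by transience, Thm 7.1 — all proved in the tree from Cor. 3.5) [cite: RohdeSchramm2005, Cor. 7.4 and Thm 7.1], and the library's `IsSLECurve κ D Γ` asserts that generation almost surely, so every `z ∈ D` is `φ(γ(t))`, a point of the compactified image curve; on the other side, a family with `|γ_δ| ≤ C/δ` w.h.p. has limits whose `ρ`-tubes have volume `≤ 9π(C+1)ρ` a.s. (closed condition, portmanteau [cite: Billingsley1999, Thm 2.1]), whereas the `ρ`-tube of a curve onto `D` contains a ball `B(w₀, r) ⊆ D` of area `πr²`; subcritical fugacity laws are such families (`cₙ xⁿ` summable for `x < 1/μ` [cite: MadrasSlade1993, §1.2], `…SubcriticalLength`)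
- evasions_known: none for the obstructed conclusions; the catalogue's list (i)–(ix) stands with ONE sharpening: (vii) "`x`-robust conclusions compatible with onto limits … 'SLE_κ for some `κ(x)`' … predicted for all `x ≥ x_c`" is RIGHT-half-open only — two-sided versions are refuted (no SLE at any `x < x_c`), and on `[x_c, x_c + ε)` the admissible `κ(x)` is `≥ 8` for `x > x_c`, so `κ(x)` is discontinuous at `x_c` [cite: DuminilCopinKozmaYadin2014, Conjecture 11]; of the (vii)-conclusions only those also true of the degenerate subcritical limit (tightness, existence of subsequential limits, support on curves from `a` to `b`, reversibility, domain Markov property) can be two-sidedly robust — "conformally invariant NON-DEGENERATE limit" cannot (the subcritical limit is expected to be the geodesic / straight chord [cite: DuminilCopinKozmaYadin2014, §1 (When x < 1/μ)] [cite: BetzTaggi2019, §1], and chords of the disc are not conformally natural); NOT obstructed and recorded for planners: (x) the EXISTENTIAL reading — `SAWScalingLimit ↔ ∃ x > 0, SAWScalingLimitAt x` (`SupercriticalSAW.sawScalingLimit_iff_exists_pos`): the fugacity may be treated as an unknown pinned by a balance or variational condition, no knowledge of `μ(ℤ²)` ("no closed formula exists in general" [cite: DuminilCopinKozmaYadin2014,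 §1]) being required, and an SLE_κ (`κ < 8`) limit at the resulting `x` locates `x_c` exactly; (xi) DATA-DRIVEN (mesh-dependent, tuned) fugacities `x_δ` chosen by a balance condition at mesh `δ` — e.g. a fixed avoidance probability `P_{x_δ,δ}[γ_δ ∩ U = ∅] = 1/2` for an open `U` off the chord, which exists by continuity in `x` (finite sums) and the intermediate value theorem between `x → 0⁺` (concentration on lattice geodesics) and `x = x_c + 1` (Theorem 1) — are window sequences of type (i) (`…Narrow`): their subsequential limits are NOT onto by the closed-set portmanteau, hence immune to the space-filling mechanism, and whether `x_δ - x_c = o(δ²)` along a subsequence (then the CRITICAL law has non-onto subsequential limits, a weak form of Problem 10 for the disc [cite: DuminilCopinKozmaYadin2014, Problem 10]) or not (an intermediate near-critical regime) is open — nothing in the catalogue decides it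
- scope_caveats: those of the earlier audits; the phase constraint is proved for the unit disc — the subcritical exclusion for any endpoints in `𝔻_δ`, the supercritical `κ ≥ 8` clause for the closest-site endpoints of `(𝔻; 1, -1)` (Theorem 1 is printed for the disc; general domains only after microscopic expansion, Theorem 2 [cite: DuminilCopinKozmaYadin2014, Theorem 2]); at `x = x_c` nothing is excluded (all `κ > 0` remain formally possible: "not onto" is Problem 10, "not thin" has no machine-checked proof); `κ = 8` versus `κ > 8` above `x_c` is undecided (Conjecture 11 predicts SLE₈ [cite: DuminilCopinKozmaYadin2014, Conjecture 11]; convergence itself is open); fugacities `x ≤ 0` remain junk for `lawAt` and uncovered; the SLE₈ trace theorem [cite: LawlerSchrammWerner2004, Thm 4.7] is not an input of any declaration here (it is needed to construct an SLE₈ curve, `exists_isSLECurve`, not to use one), so "convergence to SLE₈" statements in the tree are non-vacuous only together with that construction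
- status: established (proved in the tree: `SupercriticalSAWSpaceFillingPhases_holds`, axioms `propext`, `Classical.choice`, `Quot.sound`); audit gen 6 of `…Proofs` 2026-08-16: CONFIRMED at page level [cite: DuminilCopinKozmaYadin2014, Theorem 1] [cite: RohdeSchramm2005, Cor. 7.4] and STRENGTHENED — the two `κ ≥ 8` caveats of the catalogue entry (`…ProofsOnto` input, `…Subcritical` scope) are discharged; 27 citing works re-checked (4 since 2022), none evading

[cite: DuminilCopinKozmaYadin2014, Theorem 1 and Conjecture 11] -/
def SupercriticalSAWSpaceFillingPhases : Prop :=
  SupercriticalSAWSpaceFilling ∧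
    (∀ (κ : ℝ≥0), 8 ≤ κ → ∀ (D : DobrushinDomain) (A B : ℝ → Site 2)
      (P : ∀ δ : ℝ, Measure (DomainSAW D.carrier δ (A δ) (B δ))), (∀ δ, IsFiniteMeasure (P δ)) →
        ConvergesInLawToSLE κ D (fun δ (γ : DomainSAW D.carrier δ (A δ) (B δ)) => γ.curve) P →
          IsSpaceFillingLaws D.carrier A B P) ∧
    (∀ (x : ℝ), 0 < x → ∀ (κ : ℝ≥0), 0 < κ → ∀ A B : ℝ → Site 2,
      (∀ δ : ℝ, 0 < δ → IsClosestSite unitDisk δ 1 (A δ) ∧ IsClosestSite unitDisk δ (-1) (B δ)) →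
        ConvergesInLawToSLE κ DobrushinDomain.unitDisc
            (fun δ (γ : DomainSAW DobrushinDomain.unitDisc.carrier δ (A δ) (B δ)) => γ.curve)
            (fun δ => lawAt x DobrushinDomain.unitDisc.carrier δ (A δ) (B δ)) →
          x = criticalFugacity ∨ (criticalFugacity < x ∧ 8 ≤ κ))

/-- **The audited barrier holds**: Theorem 1 is `SupercriticalSAWSpaceFilling_holds`
(`…TilesTheorem6`), clause (a) is `isSpaceFillingLaws_of_convergesInLawToSLE_of_eight_le`,
clause (b) is `eq_criticalFugacity_or_eight_le_of_convergesInLawToSLE_unitDisc`.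
[cite: DuminilCopinKozmaYadin2014, Theorem 1 and Conjecture 11] -/
theorem SupercriticalSAWSpaceFillingPhases_holds : SupercriticalSAWSpaceFillingPhases :=
  ⟨SupercriticalSAWSpaceFilling_holds,
    fun _ h8 _ _ _ _ hP h =>
      haveI := hP
      isSpaceFillingLaws_of_convergesInLawToSLE_of_eight_le h8 h,
    fun _ hx0 _ h0 _ _ hAB h =>
      eq_criticalFugacity_or_eight_le_of_convergesInLawToSLE_unitDisc hx0 h0 hAB h⟩

end Literature.Barriers.CriticalPhenomena
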